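import Mathlib
import HarnessLib.Audit
import Summits.PneNP.PneNP.Theorems.PstarPDT
import Summits.PneNP.PneNP.Theorems.PstarGapLemma

/-!
# Graph-quadratic systems: the combinatorial core of the ROUND-24 gap lemma

FRONTIER material of the `pnp-ideate` cell (ROUND 24); nothing here bears on `P vs NP`.

`PstarGapLemma.PstarGapLemmaSO` (the live crux of the parity-decision-tree depth route, see that file) asks that every minimal
`W`-infeasible set `J` of outputs of an expanding typed pure-`P⋆` instance with simple overlaps and AND-degree `≤ Δ` has
`#J ≤ K(Δ)·#W`.  This file isolates the special case in which the XOR edges of `J` are pairwise disjoint — there expansion is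
vacuous, the XOR variables can be eliminated, and what is left is a purely algebraic statement about quadratic equations supported
on a bounded-degree graph.  It is the case a proof must handle first and the natural place to look for a counterexample.

**Graph-quadratic systems.**  Fix `V` Boolean variables `a : Fin V → Bool` and a simple graph `E` on `Fin V` (edges as increasing
pairs).  A constraint is a triple `w = (T, S, c)` with `T ⊆ E`, read `Σ_{(p,q) ∈ T} a_p a_q + Σ_{v ∈ S} a_v = c` over `𝔽₂`
(`T = ∅` gives an affine constraint).  A system `W` is UNSAT if no `a` satisfies every constraint, and EDGE-MINIMAL on `E` if for every
edge `j ∈ E` some `a` satisfies exactly the constraints whose quadratic part avoids `j` (`EdgeMinimal`; by linear algebra over the span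
of `W` this is the same as "deleting the monomial of `j` from every constraint makes the spanned system satisfiable", i.e. the image in
the `P⋆` world of `PstarGapLemma.MinInfeasible` — see `ReductionToPstar`).

**The conjecture** `GraphQuadGap`: `∀ Δ ∃ K, unsat ∧ edge-minimal ⇒ #E ≤ K · #W`.  It is implied by `PstarGapLemmaSO` (target
`ReductionToPstar`: outputs `x_j + x'_j + a_p a_q` with fresh XOR pairs, `y = 0`, each constraint realised as the parity of
`{x_j, x'_j : j ∈ T} ∪ {a_v : v ∈ S}`), so a refutation here refutes the crux, and a proof here is its first half.

**Calibration (by hand and by search; cell kit jobs j298123 / j298151, 4.4·10⁷ sampled systems).**  (i) `c` disjoint clusters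
`K_{Δ,Δ}` (`P_i × Q_i`), the single quadratic constraint "`Σ_E a_p a_q = 1`" and the `c` affine constraints `Σ_{P_i} a = 0` form an
unsat edge-minimal system with `#E = cΔ²`, `#W = c + 1`; hence `K(Δ) ≥ Δ²·c/(c+1)`, i.e. `K(Δ) ≥ Δ² - 1` is necessary
(`clusterPair_witness` checks `Δ = 2, c = 2` by `decide`).  (ii) An implication chain of clusters (`L_1 = 1`, `L_i (L_{i+1}+1) = 0`,
`L_{s+1} = 0`, `L_i = Σ_{P_i} a`, `|P_i| = Δ/2`) is unsat edge-minimal with `s` quadratic and `2` affine constraints and `#E = sΔ²/4`.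
(iii) The random search found no system with `#E/#W` above `Δ²/2` inside its sampled space (`#E ≤ 16`), consistent with (i)–(ii).

**What is proved elsewhere / targeted here.**  ONE quadratic constraint (`GraphQuadGapOne`, target): unsat forces the form
`Σ_E a_p a_q` to be affine on the affine space cut out by the `t₀` affine constraints, so `rank_{𝔽₂} B_E ≤ 2 t₀`, and a bounded-degree
graph form has `#E ≤ Δ² · rank B_E` (greedy induced matching) — tight up to the factor `2` by (i).  TWO quadratic constraints
(`GraphQuadGapTwo`, target): the solution count is `2^{-2} Σ_{S ⊆ [2]} ε_S` with `|ε_S| ∈ {0, 2^{dim A - h_S}}` (`h_S` = half-rank on `A`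
of the form of `T_S`), so unsat forces two of the three forms `T_1, T_2, T_1 △ T_2` to have `h ≤ 2` (or one to be affine on `A`), and
`E ⊆ T_S ∪ T_{S'}` bounds `#E ≤ 4Δ²·#W`.  For a bounded number `s` of quadratic constraints the same bias identity plus Dickson
splitting gives a finite `K(Δ, s)`; the conjecture is that `K` does not depend on `s`.  The danger named by the cell: many quadratic
constraints whose low-rank parts are killed by shared affine constraints (an `s·t₀` instead of `s + t₀` law) — not realised by any
construction found so far (degree `Δ` caps how many forms one affine constraint can degenerate).
-/

set_option linter.dupNamespace false

namespace Summit.PneNP.PneNP.Theorems.PstarGraphQuadGap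

open Finset
open Summit.PneNP.PneNP.Theorems.PstarPDT (parity)

/-- An edge: an ordered pair of variables (simple graphs use increasing pairs, see `Simple`). -/
abbrev Edge (V : ℕ) := Fin V × Fin V

/-- A constraint `(T, S, c)`: `Σ_{(p,q) ∈ T} a_p a_q + Σ_{v ∈ S} a_v = c` over `𝔽₂`. -/
abbrev QCon (V : ℕ) := Finset (Edge V) × Finset (Fin V) × Bool

variable {V : ℕ}

/-- The value `Σ_{(p,q) ∈ T} a_p a_q + Σ_{v ∈ S} a_v` of the left-hand side of the constraint `w = (T, S, c)` at `a`. -/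
def qval (w : QCon V) (a : Fin V → Bool) : Bool :=
  xor (decide (Odd ((w.1.filter fun e => a e.1 = true ∧ a e.2 = true).card))) (parity w.2.1 a)

/-- `a` satisfies the constraint `w`. -/
def QHolds (w : QCon V) (a : Fin V → Bool) : Prop := qval w a = w.2.2

/-- The edge set is a simple graph: edges are increasing pairs (no loops, no two copies of an edge). -/
def Simple (E : Finset (Edge V)) : Prop := ∀ e ∈ E, e.1 < e.2

/-- Every variable lies on at most `Δ` edges. -/
def EdgeMaxDegree (Δ : ℕ) (E : Finset (Edge V)) : Prop :=
  ∀ v : Fin V, (E.filter fun e => e.1 = v ∨ e.2 = v).card ≤ Δ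

/-- Every quadratic part is supported on the edge set `E`. -/
def Supported (E : Finset (Edge V)) (W : Finset (QCon V)) : Prop := ∀ w ∈ W, w.1 ⊆ E

/-- No assignment satisfies every constraint of `W`. -/
def Unsat (W : Finset (QCon V)) : Prop := ¬ ∃ a : Fin V → Bool, ∀ w ∈ W, QHolds w a

/-- Edge-minimality: for every edge `j` some assignment satisfies exactly the constraints whose quadratic part avoids `j`
(equivalently, by linear algebra on the span of `W`: deleting the monomial of `j` makes the spanned system satisfiable). -/
def EdgeMinimal (E : Finset (Edge V)) (W : Finset (QCon V)) : Prop :=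
  ∀ j ∈ E, ∃ a : Fin V → Bool, ∀ w ∈ W, (QHolds w a ↔ j ∉ w.1)

/-- The number of genuinely quadratic constraints of `W`. -/
def quadCount (W : Finset (QCon V)) : ℕ := (W.filter fun w => w.1 ≠ ∅).card

/-- **Conjecture (graph-quadratic gap; the XOR-disjoint core of `PstarGapLemma.PstarGapLemmaSO`).**  For every degree bound `Δ`
there is `K` such that every unsat, edge-minimal graph-quadratic system on a simple graph of maximum degree `Δ` has at most `K` times
as many edges as constraints.  Necessary: `K ≥ Δ² - 1` (cluster chains, module docstring (i)).  Why it might fail: an `s·t₀` law —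
many quadratic constraints degenerated by shared affine constraints — though bounded degree caps the sharing and no construction is
known; kit searches j298123/j298151 found nothing above `Δ²/2` for `#E ≤ 16`. -/
@[conjecture] def GraphQuadGap : Prop :=
  ∀ Δ : ℕ, ∃ K : ℕ, ∀ (V : ℕ) (E : Finset (Edge V)) (W : Finset (QCon V)),
    Simple E → EdgeMaxDegree Δ E → Supported E W → Unsat W → EdgeMinimal E W → E.card ≤ K * W.card

/-- **TARGET (provable; one quadratic constraint).**  With at most one genuinely quadratic constraint, unsatisfiability makes the
graph form `Σ_E a_p a_q` affine on the affine space of the `t₀` affine constraints, so `rank_{𝔽₂} B_E ≤ 2 t₀`; and a form on a graph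
of maximum degree `Δ` has `#E ≤ Δ² · rank B_E` (an induced matching of size `ν` gives rank `≥ 2ν`, and greedy gives
`ν ≥ #E / (2Δ²)`).  Hence `#E ≤ 2Δ² · #W`.  Sources: cell memo ROUND-24-PRESEED §12 (polarisation + induced matching). -/
@[conjecture] def GraphQuadGapOne : Prop :=
  ∀ (Δ V : ℕ) (E : Finset (Edge V)) (W : Finset (QCon V)),
    Simple E → EdgeMaxDegree Δ E → Supported E W → Unsat W → EdgeMinimal E W → quadCount W ≤ 1 →
      E.card ≤ 2 * Δ ^ 2 * W.card

/-- **TARGET (provable; two quadratic constraints).**  Bias identity `#solutions = ¼ Σ_{S ⊆ [2]} ε_S`, `|ε_S| ∈ {0, 2^{dim A - h_S}}`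
with `h_S` the half-rank on the affine solution space `A` of the affine constraints of the form of `T_S` (`T_∅ = ∅`, `T_{12} = T_1 △ T_2`):
unsat forces `{h_1, h_2, h_{12}}` to contain two values `≤ 2` or one value `0`; each such `T_S` has `#T_S ≤ Δ²(2 h_S + 2 t₀)` and the two
of them cover `E` (edge-minimality puts every edge in `T_1 ∪ T_2`).  Hence `#E ≤ 4Δ² · #W`. -/
@[conjecture] def GraphQuadGapTwo : Prop :=
  ∀ (Δ V : ℕ) (E : Finset (Edge V)) (W : Finset (QCon V)),
    Simple E → EdgeMaxDegree Δ E → Supported E W → Unsat W → EdgeMinimal E W → quadCount W ≤ 2 →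
      E.card ≤ 4 * Δ ^ 2 * W.card

/-- **TARGET (provable; the reduction).**  The crux implies the graph-quadratic conjecture: realise the graph system as the fibre
`y = 0` of the pure-`P⋆` instance with outputs `x_j + x'_j + a_p a_q` (`j = (p,q) ∈ E`, fresh XOR pairs), which is typed, has simple
overlaps (the graph is simple), AND-degree `≤ Δ`, and is boundary-expanding for every `r` (every output owns two private XOR slots);
a constraint `(T, S, c)` becomes the parity of `{x_j, x'_j : j ∈ T} ∪ {a_v : v ∈ S}`; `Unsat ∧ EdgeMinimal` becomes
`PstarGapLemma.MinInfeasible _ 0 W' univ` with `#W' = #W`. -/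
@[conjecture] def ReductionToPstar : Prop :=
  Summit.PneNP.PneNP.Theorems.PstarGapLemma.PstarGapLemmaSO → GraphQuadGap

/-! ## Sanity checks -/

/-- The empty system is satisfiable. -/
theorem not_unsat_empty : ¬ Unsat (∅ : Finset (QCon V)) := by
  unfold Unsat; push Not; exact ⟨fun _ => false, by simp⟩

/-- An unsat system with no quadratic part at all has no edge-minimal edges: `EdgeMinimal E W` forces `E = ∅`. -/
theorem eq_empty_of_affine {E : Finset (Edge V)} {W : Finset (QCon V)}
    (hq : ∀ w ∈ W, w.1 = ∅) (hu : Unsat W) (hm : EdgeMinimal E W) : E = ∅ := by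
  by_contra hE
  obtain ⟨j, hj⟩ := Finset.nonempty_iff_ne_empty.mpr hE
  obtain ⟨a, ha⟩ := hm j hj
  exact hu ⟨a, fun w hw => (ha w hw).mpr (by simp [hq w hw])⟩

section witness

/-- The cluster `K_{2,2}` on `{0,1} × {2,3}`. -/
def k22 : Finset (Edge 4) := {((0 : Fin 4), (2 : Fin 4)), (0, 3), (1, 2), (1, 3)}

/-- Two constraints: the quadratic `Σ_E a_p a_q = 1` and the affine `a_0 + a_1 = 0`. -/
def k22System : Finset (QCon 4) := {(k22, ∅, true), (∅, {(0 : Fin 4), 1}, false)}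

/-- Every assignment of four Booleans is a matrix vector (lets `decide` run over `Bool⁴` instead of `Fin 4 → Bool`). -/
private theorem eq_vec (a : Fin 4 → Bool) : a = ![a 0, a 1, a 2, a 3] := by
  ext i; fin_cases i <;> rfl

/-- The quadratic constraint of `k22System`. -/
private def cQ : QCon 4 := (k22, ∅, true)
/-- The affine constraint of `k22System`. -/
private def cA : QCon 4 := (∅, {(0 : Fin 4), 1}, false)

/-- `k22System` spelled with the two named constraints. -/
private theorem k22System_eq : k22System = {cQ, cA} := rfl

set_option maxRecDepth 8000 in
/-- No vector in `Bool⁴` satisfies both constraints (`a₀ + a₁ = 0` kills `(a₀ + a₁)(a₂ + a₃)`). -/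
private theorem k22_unsat_vec :
    ∀ b₀ b₁ b₂ b₃ : Bool, ¬ (QHolds cQ ![b₀, b₁, b₂, b₃] ∧ QHolds cA ![b₀, b₁, b₂, b₃]) := by
  unfold cQ cA k22 QHolds qval parity; decide

set_option maxRecDepth 8000 in
/-- Every edge is necessary: some vector satisfies the affine constraint and violates the quadratic one minus that edge's monomial. -/
private theorem k22_minimal_vec :
    ∀ j ∈ k22, ∃ b : Bool × Bool × Bool × Bool,
      (QHolds cQ ![b.1, b.2.1, b.2.2.1, b.2.2.2] ↔ j ∉ cQ.1) ∧
      (QHolds cA ![b.1, b.2.1, b.2.2.1, b.2.2.2] ↔ j ∉ cA.1) := by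
  unfold cQ cA k22 QHolds qval parity; decide

/-- **Calibration witness `K(2) ≥ 2`.**  The `K_{2,2}` cluster with one quadratic and one affine constraint is an unsat,
edge-minimal graph-quadratic system of maximum degree `2` with `4` edges and `2` constraints (so `GraphQuadGap` needs `K ≥ 2` at
`Δ = 2`; chains of `c` such clusters give `4c` edges for `c + 1` constraints). -/
theorem clusterPair_witness :
    Simple k22 ∧ EdgeMaxDegree 2 k22 ∧ Supported k22 k22System ∧ Unsat k22System ∧ EdgeMinimal k22 k22System ∧
      k22.card = 4 ∧ k22System.card = 2 := by
  refine ⟨?_, ?_, ?_, ?_, ?_, ?_, ?_⟩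
  · unfold Simple k22; decide
  · unfold EdgeMaxDegree k22; decide
  · intro w hw
    rw [k22System_eq, Finset.mem_insert, Finset.mem_singleton] at hw
    rcases hw with rfl | rfl
    · exact subset_of_eq rfl
    · exact Finset.empty_subset _
  · rintro ⟨a, ha⟩
    refine k22_unsat_vec (a 0) (a 1) (a 2) (a 3) ?_
    rw [← eq_vec a]
    exact ⟨ha cQ (by rw [k22System_eq]; simp), ha cA (by rw [k22System_eq]; simp)⟩
  · intro j hj
    obtain ⟨b, hQ, hA⟩ := k22_minimal_vec j hj
    refine ⟨![b.1, b.2.1, b.2.2.1, b.2.2.2], fun w hw => ?_⟩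
    rw [k22System_eq, Finset.mem_insert, Finset.mem_singleton] at hw
    rcases hw with rfl | rfl
    · exact hQ
    · exact hA
  · unfold k22; decide
  · rw [k22System_eq]; unfold cQ cA k22; decide

end witness

end Summit.PneNP.PneNP.Theorems.PstarGraphQuadGap
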